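import Summits.QuantumFields.YangMills.Theorems.AlphaInputsT3ACv3SphereAxialGaugeRing
import Summits.QuantumFields.YangMills.Theorems.AlphaInputsT3ACv3GlueLedger
import Literature.MathematicalPhysics.QuantumFieldTheory.Balaban1983to89.BlockAveragingFederbush
import Literature.Analysis.Complex.RungeUnits
import HarnessLib

/-!
# `AlphaInputsT3ACv3SphereAxialGaugeTop` — non-abelian (FL), START v3 row (S3), part 3: **THE TOP FACE OF THE BOUNDARY GAUGE OF A LATTICE CUBE (COONS SPREADING)** — toward: for `U : (Fin 3 → ℤ) → Fin 3 → SU(n)` whose plaquettes ON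
# THE BOUNDARY of `[−R,R]³` are within `b` of `1`, and `320·R²·b ≤ 1`, `|n|·20R²b < π`, there is `σ : (Fin 3 → ℤ) → SU(n)` with `‖σ(u)·U(u,μ)·σ(u+e_μ)⁻¹ − 1‖ ≤ 200·R·b` on EVERY
# boundary (tangential) bond — the five-face tree gauge of part 1 on the bottom and the sides, and on the top face the column transports corrected by the transfinite (Coons) interpolant of
# the logarithm of the ring mismatch (a sphere admits no uniformly thin tree gauge; the `O(R²b)` top-ring holonomy is SPREAD over the `2R` bonds of each column) — cell `ym3-torus`, width
# seat `ym-ust-19936-w5` (g2), row (S3) of ★w1-19936 g2 LEAD memo `NONABELIAN-FL-START-w1-g2.md` §3 (B)∕§4, carriers of the LEAD's 02:22:38Z post (model box, d = 3 literal)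

WHY (OWNER RULING 19936 (FL) START 2026-08-28T02:16:33Z; LEAD memo §3 (B): the vertex BALL of START v3 is filled from its boundary data through «comb-axial gauge `σ` on the lattice sphere `∂Q`
(`|mlog data^σ| ≤ 6R·b` per bond — uniformly small …)», then ★w3's transfinite fill (S4) and `(e^{A})^{σ̃⁻¹}`; the fill's plaquettes are `≤ C(b + sup|A_∂|/R)`, so the boundary gauge must be
UNIFORMLY `O(R·b)`-flat on all `≈ 48R²` boundary bonds).  Part 1 (`…SphereAxialGaugeDisc`) gauges the bottom and the four sides by a tree (`≤ 4R·b`); no tree can do the closed surface (this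
seat's LOCATED point, STATUS 03:0xZ); part 2 (`…SphereAxialGaugeRing`) sizes the ring mismatch `ν`.  THIS FILE spreads it over the top face `z = R` (offsets `(a, s)`, `N = 2R`):
* §1 matrix letters (`FederbushMean.dist1_SU_eq` for `dist1 = ‖· − 1‖`): `norm_conj_unitary_sub_one_le` (`‖E·c·E′* − 1‖ ≤ ‖c − 1‖ + ‖E − E′‖`), `norm_inv_mul_mul_sub_le` (`‖g⁻¹·ν·c − ν‖ ≤ dist1 g + dist1 c`), `logSU` (one def: the
  `𝔰𝔲(n)`-valued logarithm of `V ∈ SU(n)` when `‖V − 1‖ ≤ 1/4 ∧ |n|‖V − 1‖ < π`, else `0`; ★w4's `GlueLedger.glueData_of_near` at reference `1`), `coe_logSU`, `expSU_logSU`, `norm_logSU_le`,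
  `norm_logSU_sub_logSU_le` (`FederbushMean.norm_mlog_sub_mlog_le` at `ρ = 1/4`: factor `4/3`);
* (part 2, `…SphereAxialGaugeRing`, any gauge group: the columns `sigmaCol`, the ring mismatch `nu`, the `rung`, and their `dist1` bounds;)
* §3 the COONS interpolant `psi` of `F := logSU ∘ nu` from the ring into the face (def, an element of `𝔰𝔲(n)`): exact on the four edges (`psi_edge_*`), `‖ψ‖ ≤ 6·(10N²b)`, Lipschitz
  `‖Δ_a ψ‖ ≤ 46N·b`, `‖Δ_s ψ‖ ≤ 26N·b`; `sigmaTop := expSU ψ · sigmaCol` (def) AGREES with `σ_T` on the ring (`sigmaTop_eq_sigmaT_of_ring`), and its gauged top bonds are within `70N·b`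
  (rungs) ∕ `38N·b` (columns) of `1` (`Literature.Analysis.Complex.norm_exp_sub_exp_le`);
* part 4 (`…SphereAxialGauge`): ★★★ `exists_sphereAxialGauge` — the (S3) statement in the LEAD's carriers (`u : Fin 3 → ℤ`, predicates unfolded), conclusion `≤ 200·R·b` on every
  boundary bond, assembled from parts 1–3.
SMALLNESS.  `320·R²·b ≤ 1` (top-ring mismatch `≤ 20R²b ≤ 1/16`, so all logarithms are honest and `e^{‖ψ‖} ≤ e^{3/8}`) and `|n|·(20R²b) < π` (trace-freeness of `mlog`; void for `n = Fin 2`).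
In START v3 (B): `R = L^k/4`, `b = 64εL^{−2k}` ⇒ `R²b = 4ε` — the row is `1280·ε ≤ 1`, absolute.
HONEST FRAMING.  Group∕matrix bookkeeping over part 1 and landed letters; count-neutral helper toward R3 2′ (items 19936∕19935, `--supports stmt-QuantumFields-19936`); `hLift`∕(FL), the stub
`stub_laneRecordsV3Chi`, the crux `HistoryTailL` and the gap are NOT claimed; registry untouched; YM₃ on T³ is rung R3 of the YM ladder, not the Clay problem.

References: T. Bałaban, Commun. Math. Phys. 98 (1985) 17–51 [Balaban1985Averaging] ((8)–(9) p.18, (19)–(20) p.21, pp.24–25); Commun. Math. Phys. 99 (1985) 75–102 [Balaban1985RegularSpaces]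
(Lemma 1 (1.24)–(1.25) p.79); Commun. Math. Phys. 102 (1985) 277–309 [Balaban1985Variational] ((15), (18) p.280).
-/

set_option autoImplicit false

noncomputable section

open scoped Matrix.Norms.L2Operator
open NormedSpace

namespace Summit.QuantumFields.YangMills.Theorems.SphereAxialGauge

open Literature.MathematicalPhysics.QuantumFieldTheory.Balaban1983to89
open Literature.MathematicalPhysics.QuantumFieldTheory.Balaban1983to89.T4AdjointCovarianceUnitary (lieSU expSU coe_expSU mem_lieSU_iff)
open Literature.MathematicalPhysics.QuantumFieldTheory.Balaban1983to89.MatrixLog (mlog mlog_one exp_mlog norm_mlog_le_two_mul)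
open Summit.QuantumFields.YangMills.Theorems.GlueLedger (glueData_of_near)

variable {n : Type*} [Fintype n] [DecidableEq n] [Nonempty n]

/-! ## §1 Matrix letters and the `𝔰𝔲(n)`-valued logarithm -/

omit [Nonempty n] in
/-- `‖E·c·E′* − 1‖ ≤ ‖c − 1‖ + ‖E − E′‖` for `E, E′, c ∈ SU(n)` (`E(c−1)E′* + (E − E′)E′*`). [folklore] -/
theorem norm_conj_unitary_sub_one_le (E E' c : Matrix.specialUnitaryGroup n ℂ) :
    ‖(E : Matrix n n ℂ) * (c : Matrix n n ℂ) * star (E' : Matrix n n ℂ) - 1‖ ≤ ‖(c : Matrix n n ℂ) - 1‖ + ‖(E : Matrix n n ℂ) - (E' : Matrix n n ℂ)‖ := by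
  have hE' : (E' : Matrix n n ℂ) * star (E' : Matrix n n ℂ) = 1 := Matrix.mem_unitaryGroup_iff.mp (Matrix.specialUnitaryGroup_le_unitaryGroup E'.2)
  have e : (E : Matrix n n ℂ) * ((c : Matrix n n ℂ) - 1) * star (E' : Matrix n n ℂ) + ((E : Matrix n n ℂ) - (E' : Matrix n n ℂ)) * star (E' : Matrix n n ℂ) =
      (E : Matrix n n ℂ) * (c : Matrix n n ℂ) * star (E' : Matrix n n ℂ) - (E' : Matrix n n ℂ) * star (E' : Matrix n n ℂ) := by
    noncomm_ring
  rw [hE'] at e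
  rw [← e]
  calc _ ≤ ‖(E : Matrix n n ℂ) * ((c : Matrix n n ℂ) - 1) * star (E' : Matrix n n ℂ)‖ + ‖((E : Matrix n n ℂ) - (E' : Matrix n n ℂ)) * star (E' : Matrix n n ℂ)‖ := norm_add_le _ _
    _ = ‖(c : Matrix n n ℂ) - 1‖ + ‖(E : Matrix n n ℂ) - (E' : Matrix n n ℂ)‖ := by
        rw [CStarRing.norm_mul_mem_unitary _ (Unitary.star_mem E'.2.1), CStarRing.norm_mem_unitary_mul _ E.2.1, CStarRing.norm_mul_mem_unitary _ (Unitary.star_mem E'.2.1)]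

/-- `‖g⁻¹·ν·c − ν‖ ≤ dist1 g + dist1 c` in `SU(n)` (`(g⁻¹ − 1)νc + ν(c − 1)`). [folklore] -/
theorem norm_inv_mul_mul_sub_le (g ν c : Matrix.specialUnitaryGroup n ℂ) :
    ‖((g⁻¹ * ν * c : Matrix.specialUnitaryGroup n ℂ) : Matrix n n ℂ) - (ν : Matrix n n ℂ)‖ ≤ dist1 g + dist1 c := by
  rw [← GaugeGroup.dist1_inv g, FederbushMean.dist1_SU_eq, FederbushMean.dist1_SU_eq, Submonoid.coe_mul, Submonoid.coe_mul]
  set A : Matrix n n ℂ := ((g⁻¹ : Matrix.specialUnitaryGroup n ℂ) : Matrix n n ℂ)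
  have e : A * (ν : Matrix n n ℂ) * (c : Matrix n n ℂ) - (ν : Matrix n n ℂ) = (A - 1) * (ν : Matrix n n ℂ) * (c : Matrix n n ℂ) + (ν : Matrix n n ℂ) * ((c : Matrix n n ℂ) - 1) := by
    noncomm_ring
  rw [e]
  calc _ ≤ ‖(A - 1) * (ν : Matrix n n ℂ) * (c : Matrix n n ℂ)‖ + ‖(ν : Matrix n n ℂ) * ((c : Matrix n n ℂ) - 1)‖ := norm_add_le _ _
    _ = ‖A - 1‖ + ‖(c : Matrix n n ℂ) - 1‖ := by
        rw [CStarRing.norm_mul_mem_unitary _ c.2.1, CStarRing.norm_mul_mem_unitary _ ν.2.1, CStarRing.norm_mem_unitary_mul _ ν.2.1]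

/-- The logarithm of `V ∈ SU(n)` is in `𝔰𝔲(n)` when `‖V − 1‖ ≤ 1/4` and `|n|·‖V − 1‖ < π` (★w4's `glueData_of_near` at the reference `1`). [cite: Balaban1985Variational, (15) p.280] -/
theorem mlog_mem_lieSU (V : Matrix.specialUnitaryGroup n ℂ) (h : ‖(V : Matrix n n ℂ) - 1‖ ≤ 1 / 4 ∧ (Fintype.card n : ℝ) * ‖(V : Matrix n n ℂ) - 1‖ < Real.pi) :
    mlog (V : Matrix n n ℂ) ∈ lieSU n ∧ ‖mlog (V : Matrix n n ℂ)‖ ≤ 2 * ‖(V : Matrix n n ℂ) - 1‖ ∧ exp (mlog (V : Matrix n n ℂ)) = (V : Matrix n n ℂ) := by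
  have e1 : (V : Matrix n n ℂ) * star (((1 : Matrix.specialUnitaryGroup n ℂ) : Matrix.specialUnitaryGroup n ℂ) : Matrix n n ℂ) = (V : Matrix n n ℂ) := by
    rw [OneMemClass.coe_one, star_one, mul_one]
  have h1 : ‖(V : Matrix n n ℂ) * star (((1 : Matrix.specialUnitaryGroup n ℂ) : Matrix.specialUnitaryGroup n ℂ) : Matrix n n ℂ) - 1‖ ≤ ‖(V : Matrix n n ℂ) - 1‖ := by rw [e1]
  obtain ⟨hs, ht, hn, he⟩ := glueData_of_near V 1 h1 h.1 h.2
  rw [e1] at hs ht hn he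
  rw [OneMemClass.coe_one, mul_one] at he
  exact ⟨mem_lieSU_iff.mpr ⟨hs, ht⟩, hn, he⟩

open Classical in
/-- **THE `𝔰𝔲(n)`-VALUED LOGARITHM** of `V ∈ SU(n)`: `mlog V` when `‖V − 1‖ ≤ 1/4 ∧ |n|·‖V − 1‖ < π`, and `0` otherwise (a total definition; only the first branch is ever used).
[cite: Balaban1985Variational, (15) p.280; Balaban1985Averaging, (20) p.21] -/
def logSU (V : Matrix.specialUnitaryGroup n ℂ) : lieSU n :=
  if h : ‖(V : Matrix n n ℂ) - 1‖ ≤ 1 / 4 ∧ (Fintype.card n : ℝ) * ‖(V : Matrix n n ℂ) - 1‖ < Real.pi then ⟨mlog (V : Matrix n n ℂ), (mlog_mem_lieSU V h).1⟩ else 0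

/-- In the small branch `logSU V` reads `mlog V`. [cite: Balaban1985Variational, (15) p.280] -/
theorem coe_logSU (V : Matrix.specialUnitaryGroup n ℂ) (h : ‖(V : Matrix n n ℂ) - 1‖ ≤ 1 / 4 ∧ (Fintype.card n : ℝ) * ‖(V : Matrix n n ℂ) - 1‖ < Real.pi) :
    ((logSU V : lieSU n) : Matrix n n ℂ) = mlog (V : Matrix n n ℂ) := by
  classical
  simp only [logSU, h, and_self, ↓reduceDIte]

/-- `expSU (logSU V) = V` in the small branch. [cite: Balaban1985Variational, (15) p.280] -/
theorem expSU_logSU (V : Matrix.specialUnitaryGroup n ℂ) (h : ‖(V : Matrix n n ℂ) - 1‖ ≤ 1 / 4 ∧ (Fintype.card n : ℝ) * ‖(V : Matrix n n ℂ) - 1‖ < Real.pi) :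
    expSU (logSU V) = V := by
  apply Subtype.ext
  rw [coe_expSU, coe_logSU V h]
  exact (mlog_mem_lieSU V h).2.2

/-- `‖logSU V‖ ≤ 2‖V − 1‖` (in both branches). [cite: Balaban1985Averaging, (20) p.21] -/
theorem norm_logSU_le (V : Matrix.specialUnitaryGroup n ℂ) : ‖((logSU V : lieSU n) : Matrix n n ℂ)‖ ≤ 2 * ‖(V : Matrix n n ℂ) - 1‖ := by
  classical
  by_cases h : ‖(V : Matrix n n ℂ) - 1‖ ≤ 1 / 4 ∧ (Fintype.card n : ℝ) * ‖(V : Matrix n n ℂ) - 1‖ < Real.pi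
  · rw [coe_logSU V h]; exact (mlog_mem_lieSU V h).2.1
  · simp only [logSU, h, ↓reduceDIte, ZeroMemClass.coe_zero, norm_zero]; positivity

/-- `logSU 1 = 0`. [folklore] -/
theorem logSU_one : ((logSU (1 : Matrix.specialUnitaryGroup n ℂ) : lieSU n) : Matrix n n ℂ) = 0 := by
  have h := norm_logSU_le (n := n) 1
  rw [OneMemClass.coe_one, sub_self, norm_zero, mul_zero] at h
  exact norm_le_zero_iff.mp h

/-- Lipschitz bound of the logarithm in the small branch: `‖logSU V − logSU V′‖ ≤ (4/3)‖V − V′‖`. [folklore] -/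
theorem norm_logSU_sub_logSU_le (V V' : Matrix.specialUnitaryGroup n ℂ)
    (h : ‖(V : Matrix n n ℂ) - 1‖ ≤ 1 / 4 ∧ (Fintype.card n : ℝ) * ‖(V : Matrix n n ℂ) - 1‖ < Real.pi)
    (h' : ‖(V' : Matrix n n ℂ) - 1‖ ≤ 1 / 4 ∧ (Fintype.card n : ℝ) * ‖(V' : Matrix n n ℂ) - 1‖ < Real.pi) :
    ‖((logSU V : lieSU n) : Matrix n n ℂ) - ((logSU V' : lieSU n) : Matrix n n ℂ)‖ ≤ 4 / 3 * ‖(V : Matrix n n ℂ) - (V' : Matrix n n ℂ)‖ := by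
  rw [coe_logSU V h, coe_logSU V' h']
  have := FederbushMean.norm_mlog_sub_mlog_le (ρ := 1 / 4) (by norm_num) h.1 h'.1
  exact this.trans (by norm_num)

/-! ## §3 The Coons spreading on the top face (matrices) -/

section Coons

variable (W : ℤ → ℤ → ℤ → Fin 3 → Matrix.specialUnitaryGroup n ℂ) (R : ℕ)

/-- The ring logarithm `F(a,s) := logSU(ν(a,s))`. [cite: Balaban1985Variational, (15) p.280] -/
def Fnu (a s : ℕ) : lieSU n := logSU (nu W R a s)

/-- **THE COONS (TRANSFINITE) INTERPOLANT** of the ring logarithm into the top face: with `r = a/2R`, `σ = s/2R`,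
`ψ(a,s) := σ·F(a,2R) + (1−r)·F(0,s) + r·F(2R,s) − (1−r)σ·F(0,2R) − rσ·F(2R,2R)` (the edge `s = 0` carries `F = 0`). [folklore] -/
def psi (a s : ℕ) : lieSU n :=
  ((s : ℝ) / (2 * R : ℕ)) • Fnu W R a (2 * R) + (1 - (a : ℝ) / (2 * R : ℕ)) • Fnu W R 0 s + ((a : ℝ) / (2 * R : ℕ)) • Fnu W R (2 * R) s
    - ((1 - (a : ℝ) / (2 * R : ℕ)) * ((s : ℝ) / (2 * R : ℕ))) • Fnu W R 0 (2 * R) - (((a : ℝ) / (2 * R : ℕ)) * ((s : ℝ) / (2 * R : ℕ))) • Fnu W R (2 * R) (2 * R)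

/-- **THE TOP-FACE GAUGE** `σ_top(a,s) := expSU(ψ(a,s)) · σ_col(a,s)`. [cite: Balaban1985Averaging, pp.24–25] -/
def sigmaTop (a s : ℕ) : Matrix.specialUnitaryGroup n ℂ := expSU (psi W R a s) * sigmaCol W R a s

/-- `F(a, 0) = 0` (the mismatch is `1` on the edge `s = 0`). [folklore] -/
theorem Fnu_zero_s (a : ℕ) : Fnu W R a 0 = 0 := by
  apply Subtype.ext
  rw [Fnu, nu_zero_s, logSU_one, ZeroMemClass.coe_zero]

/-- Edge `s = 0`: `ψ(a, 0) = 0`. [folklore] -/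
theorem psi_edge_s0 (a : ℕ) : psi W R a 0 = 0 := by
  simp only [psi, Fnu_zero_s, Nat.cast_zero, zero_div, zero_smul, smul_zero, mul_zero, sub_zero, add_zero]

/-- Edge `s = 2R`: `ψ(a, 2R) = F(a, 2R)` (`R ≥ 1`). [folklore] -/
theorem psi_edge_sN (hR : 1 ≤ R) (a : ℕ) : psi W R a (2 * R) = Fnu W R a (2 * R) := by
  have hN : ((2 * R : ℕ) : ℝ) ≠ 0 := by positivity
  have hdiv : ((2 * R : ℕ) : ℝ) / ((2 * R : ℕ) : ℝ) = 1 := div_self hN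
  rw [psi, hdiv]
  module

/-- Edge `a = 0`: `ψ(0, s) = F(0, s)`. [folklore] -/
theorem psi_edge_a0 (s : ℕ) : psi W R 0 s = Fnu W R 0 s := by
  rw [psi, Nat.cast_zero, zero_div]
  module

/-- Edge `a = 2R`: `ψ(2R, s) = F(2R, s)` (`R ≥ 1`). [folklore] -/
theorem psi_edge_aN (hR : 1 ≤ R) (s : ℕ) : psi W R (2 * R) s = Fnu W R (2 * R) s := by
  have hN : ((2 * R : ℕ) : ℝ) ≠ 0 := by positivity
  have hdiv : ((2 * R : ℕ) : ℝ) / ((2 * R : ℕ) : ℝ) = 1 := div_self hN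
  rw [psi, hdiv]
  module

/-- **THE TOP GAUGE AGREES WITH THE TREE GAUGE ON THE RING** (`a ∈ {0,2R}` or `s ∈ {0,2R}`) when the mismatch there is small: `σ_top(a,s) = σ_T(a,s,2R)`.
[cite: Balaban1985Averaging, pp.24–25; Balaban1985Variational, (15) p.280] -/
theorem sigmaTop_eq_sigmaT_of_ring (hR : 1 ≤ R) (a s : ℕ) (hring : a = 0 ∨ a = 2 * R ∨ s = 0 ∨ s = 2 * R)
    (hsmall : ‖((nu W R a s : Matrix.specialUnitaryGroup n ℂ) : Matrix n n ℂ) - 1‖ ≤ 1 / 4 ∧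
      (Fintype.card n : ℝ) * ‖((nu W R a s : Matrix.specialUnitaryGroup n ℂ) : Matrix n n ℂ) - 1‖ < Real.pi) :
    sigmaTop W R a s = sigmaT W R a s (2 * R) := by
  have hψ : psi W R a s = Fnu W R a s := by
    rcases hring with h | h | h | h
    · subst h; exact psi_edge_a0 W R s
    · subst h; exact psi_edge_aN W R hR s
    · subst h; rw [psi_edge_s0, Fnu_zero_s]
    · subst h; exact psi_edge_sN W R hR a
  rw [sigmaTop, hψ, Fnu, expSU_logSU _ hsmall, nu]; group

/-- The gauged TOP RUNG is `expSU(ψ) · rung · expSU(ψ′)⁻¹`. [folklore] -/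
theorem gaugedTopX_eq (a s : ℕ) :
    sigmaTop W R a s * W (-(R : ℤ) + a) (-(R : ℤ) + s) (-(R : ℤ) + (2 * R : ℕ)) 0 * (sigmaTop W R (a + 1) s)⁻¹ = expSU (psi W R a s) * rung W R a s * (expSU (psi W R (a + 1) s))⁻¹ := by
  rw [sigmaTop, sigmaTop, rung]; group

/-- The gauged TOP COLUMN bond is `expSU(ψ) · expSU(ψ′)⁻¹`. [folklore] -/
theorem gaugedTopY_eq (a s : ℕ) :
    sigmaTop W R a s * W (-(R : ℤ) + a) (-(R : ℤ) + s) (-(R : ℤ) + (2 * R : ℕ)) 1 * (sigmaTop W R a (s + 1))⁻¹ = expSU (psi W R a s) * 1 * (expSU (psi W R a (s + 1)))⁻¹ := by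
  rw [sigmaTop, sigmaTop, sigmaCol_succ]; group

omit [Nonempty n] in
/-- Norm of the five-term Coons combination: `≤ 3·m_F` when every ring logarithm is `≤ m_F` and `0 ≤ r, σ ≤ 1`. [folklore] -/
theorem norm_coons_le (A B C D E : Matrix n n ℂ) {r σ mF : ℝ} (hr0 : 0 ≤ r) (hr1 : r ≤ 1) (hσ0 : 0 ≤ σ) (hσ1 : σ ≤ 1)
    (hA : ‖A‖ ≤ mF) (hB : ‖B‖ ≤ mF) (hC : ‖C‖ ≤ mF) (hD : ‖D‖ ≤ mF) (hE : ‖E‖ ≤ mF) :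
    ‖σ • A + (1 - r) • B + r • C - ((1 - r) * σ) • D - (r * σ) • E‖ ≤ 3 * mF := by
  have h1 : ‖σ • A‖ ≤ σ * mF := by rw [norm_smul, Real.norm_eq_abs, abs_of_nonneg hσ0]; exact mul_le_mul_of_nonneg_left hA hσ0
  have h2 : ‖(1 - r) • B‖ ≤ (1 - r) * mF := by
    rw [norm_smul, Real.norm_eq_abs, abs_of_nonneg (by linarith)]; exact mul_le_mul_of_nonneg_left hB (by linarith)
  have h3 : ‖r • C‖ ≤ r * mF := by rw [norm_smul, Real.norm_eq_abs, abs_of_nonneg hr0]; exact mul_le_mul_of_nonneg_left hC hr0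
  have h4 : ‖((1 - r) * σ) • D‖ ≤ (1 - r) * σ * mF := by
    rw [norm_smul, Real.norm_eq_abs, abs_of_nonneg (by nlinarith)]; exact mul_le_mul_of_nonneg_left hD (by nlinarith)
  have h5 : ‖(r * σ) • E‖ ≤ r * σ * mF := by
    rw [norm_smul, Real.norm_eq_abs, abs_of_nonneg (by nlinarith)]; exact mul_le_mul_of_nonneg_left hE (by nlinarith)
  have hmF : 0 ≤ mF := (norm_nonneg _).trans hA
  calc _ ≤ ‖σ • A + (1 - r) • B + r • C - ((1 - r) * σ) • D‖ + ‖(r * σ) • E‖ := norm_sub_le _ _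
    _ ≤ (‖σ • A + (1 - r) • B + r • C‖ + ‖((1 - r) * σ) • D‖) + ‖(r * σ) • E‖ := by gcongr; exact norm_sub_le _ _
    _ ≤ ((‖σ • A‖ + ‖(1 - r) • B‖ + ‖r • C‖) + ‖((1 - r) * σ) • D‖) + ‖(r * σ) • E‖ := by gcongr; exact norm_add₃_le
    _ ≤ ((σ * mF + (1 - r) * mF + r * mF) + (1 - r) * σ * mF) + r * σ * mF := by gcongr
    _ = (1 + 2 * σ) * mF := by ring
    _ ≤ 3 * mF := by nlinarith

variable {W R}

/-- **SIZE OF `ψ`**: `‖ψ(a,s)‖ ≤ 3·m_F` for `a, s ≤ 2R` when the ring logarithms entering it are `≤ m_F`. [folklore] -/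
theorem norm_psi_le (hR : 1 ≤ R) {mF : ℝ} (hF : ∀ a s : ℕ, a ≤ 2 * R → s ≤ 2 * R → (a = 0 ∨ a = 2 * R ∨ s = 2 * R) → ‖((Fnu W R a s : lieSU n) : Matrix n n ℂ)‖ ≤ mF)
    (a s : ℕ) (ha : a ≤ 2 * R) (hs : s ≤ 2 * R) : ‖((psi W R a s : lieSU n) : Matrix n n ℂ)‖ ≤ 3 * mF := by
  have hN : (0 : ℝ) < ((2 * R : ℕ) : ℝ) := by positivity
  have hr1 : (a : ℝ) / (2 * R : ℕ) ≤ 1 := by rw [div_le_one hN]; exact_mod_cast ha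
  have hσ1 : (s : ℝ) / (2 * R : ℕ) ≤ 1 := by rw [div_le_one hN]; exact_mod_cast hs
  have e : ((psi W R a s : lieSU n) : Matrix n n ℂ) = ((s : ℝ) / (2 * R : ℕ)) • ((Fnu W R a (2 * R) : lieSU n) : Matrix n n ℂ) +
      (1 - (a : ℝ) / (2 * R : ℕ)) • ((Fnu W R 0 s : lieSU n) : Matrix n n ℂ) + ((a : ℝ) / (2 * R : ℕ)) • ((Fnu W R (2 * R) s : lieSU n) : Matrix n n ℂ) -
      ((1 - (a : ℝ) / (2 * R : ℕ)) * ((s : ℝ) / (2 * R : ℕ))) • ((Fnu W R 0 (2 * R) : lieSU n) : Matrix n n ℂ) -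
      (((a : ℝ) / (2 * R : ℕ)) * ((s : ℝ) / (2 * R : ℕ))) • ((Fnu W R (2 * R) (2 * R) : lieSU n) : Matrix n n ℂ) := by
    simp only [psi, Submodule.coe_add, Submodule.coe_sub, Submodule.coe_smul]
  rw [e]
  exact norm_coons_le _ _ _ _ _ (by positivity) hr1 (by positivity) hσ1 (hF a _ ha le_rfl (Or.inr (Or.inr rfl))) (hF 0 s (Nat.zero_le _) hs (Or.inl rfl))
    (hF _ s le_rfl hs (Or.inr (Or.inl rfl))) (hF 0 _ (Nat.zero_le _) le_rfl (Or.inl rfl)) (hF _ _ le_rfl le_rfl (Or.inr (Or.inl rfl)))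

/-- **`a`-LIPSCHITZ BOUND OF `ψ`**: `‖ψ(a+1,s) − ψ(a,s)‖ ≤ ℓ_a + 4·m_F/(2R)`. [folklore] -/
theorem norm_psi_succ_a_sub_le (hR : 1 ≤ R) {mF ℓa : ℝ}
    (hF : ∀ a s : ℕ, a ≤ 2 * R → s ≤ 2 * R → (a = 0 ∨ a = 2 * R ∨ s = 2 * R) → ‖((Fnu W R a s : lieSU n) : Matrix n n ℂ)‖ ≤ mF)
    (hLa : ∀ a : ℕ, a + 1 ≤ 2 * R → ‖((Fnu W R (a + 1) (2 * R) : lieSU n) : Matrix n n ℂ) - ((Fnu W R a (2 * R) : lieSU n) : Matrix n n ℂ)‖ ≤ ℓa)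
    (a s : ℕ) (ha : a + 1 ≤ 2 * R) (hs : s ≤ 2 * R) :
    ‖((psi W R (a + 1) s : lieSU n) : Matrix n n ℂ) - ((psi W R a s : lieSU n) : Matrix n n ℂ)‖ ≤ ℓa + 4 * mF / (2 * R : ℕ) := by
  have hN : (0 : ℝ) < ((2 * R : ℕ) : ℝ) := by positivity
  have hσ0 : 0 ≤ (s : ℝ) / (2 * R : ℕ) := by positivity
  have hσ1 : (s : ℝ) / (2 * R : ℕ) ≤ 1 := by rw [div_le_one hN]; exact_mod_cast hs
  set A := ((Fnu W R a (2 * R) : lieSU n) : Matrix n n ℂ)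
  set A' := ((Fnu W R (a + 1) (2 * R) : lieSU n) : Matrix n n ℂ)
  set B := ((Fnu W R 0 s : lieSU n) : Matrix n n ℂ)
  set C := ((Fnu W R (2 * R) s : lieSU n) : Matrix n n ℂ)
  set D := ((Fnu W R 0 (2 * R) : lieSU n) : Matrix n n ℂ)
  set E := ((Fnu W R (2 * R) (2 * R) : lieSU n) : Matrix n n ℂ)
  have e : ((psi W R (a + 1) s : lieSU n) : Matrix n n ℂ) - ((psi W R a s : lieSU n) : Matrix n n ℂ) =
      ((s : ℝ) / (2 * R : ℕ)) • (A' - A) + (1 / ((2 * R : ℕ) : ℝ)) • (C - B) + (((s : ℝ) / (2 * R : ℕ)) / ((2 * R : ℕ) : ℝ)) • (D - E) := by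
    simp only [psi, Submodule.coe_add, Submodule.coe_sub, Submodule.coe_smul, A, A', B, C, D, E]
    push_cast
    module
  rw [e]
  have hB := hF 0 s (Nat.zero_le _) hs (Or.inl rfl)
  have hC := hF _ s le_rfl hs (Or.inr (Or.inl rfl))
  have hD := hF 0 _ (Nat.zero_le _) le_rfl (Or.inl rfl)
  have hE := hF _ _ le_rfl le_rfl (Or.inr (Or.inl rfl))
  have hmF : 0 ≤ mF := (norm_nonneg _).trans hB
  have h1 : ‖((s : ℝ) / (2 * R : ℕ)) • (A' - A)‖ ≤ ℓa := by
    rw [norm_smul, Real.norm_eq_abs, abs_of_nonneg hσ0]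
    calc _ ≤ 1 * ‖A' - A‖ := mul_le_mul_of_nonneg_right hσ1 (norm_nonneg _)
      _ ≤ ℓa := by rw [one_mul]; exact hLa a ha
  have h2 : ‖(1 / ((2 * R : ℕ) : ℝ)) • (C - B)‖ ≤ 2 * mF / (2 * R : ℕ) := by
    rw [norm_smul, Real.norm_eq_abs, abs_of_nonneg (by positivity)]
    calc _ ≤ (1 / ((2 * R : ℕ) : ℝ)) * (‖C‖ + ‖B‖) := mul_le_mul_of_nonneg_left (norm_sub_le _ _) (by positivity)
      _ ≤ (1 / ((2 * R : ℕ) : ℝ)) * (mF + mF) := mul_le_mul_of_nonneg_left (add_le_add hC hB) (by positivity)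
      _ = 2 * mF / (2 * R : ℕ) := by ring
  have h3 : ‖(((s : ℝ) / (2 * R : ℕ)) / ((2 * R : ℕ) : ℝ)) • (D - E)‖ ≤ 2 * mF / (2 * R : ℕ) := by
    rw [norm_smul, Real.norm_eq_abs, abs_of_nonneg (by positivity)]
    calc _ ≤ (((s : ℝ) / (2 * R : ℕ)) / ((2 * R : ℕ) : ℝ)) * (‖D‖ + ‖E‖) := mul_le_mul_of_nonneg_left (norm_sub_le _ _) (by positivity)
      _ ≤ (1 / ((2 * R : ℕ) : ℝ)) * (mF + mF) := by
          apply mul_le_mul (div_le_div_of_nonneg_right hσ1 hN.le) (add_le_add hD hE) (by positivity) (by positivity)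
      _ = 2 * mF / (2 * R : ℕ) := by ring
  calc _ ≤ ‖((s : ℝ) / (2 * R : ℕ)) • (A' - A)‖ + ‖(1 / ((2 * R : ℕ) : ℝ)) • (C - B)‖ + ‖(((s : ℝ) / (2 * R : ℕ)) / ((2 * R : ℕ) : ℝ)) • (D - E)‖ := norm_add₃_le
    _ ≤ ℓa + 2 * mF / (2 * R : ℕ) + 2 * mF / (2 * R : ℕ) := by gcongr
    _ = ℓa + 4 * mF / (2 * R : ℕ) := by ring

/-- **`s`-LIPSCHITZ BOUND OF `ψ`**: `‖ψ(a,s+1) − ψ(a,s)‖ ≤ ℓ_s + 2·m_F/(2R)`. [folklore] -/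
theorem norm_psi_succ_s_sub_le (hR : 1 ≤ R) {mF ℓs : ℝ}
    (hF : ∀ a s : ℕ, a ≤ 2 * R → s ≤ 2 * R → (a = 0 ∨ a = 2 * R ∨ s = 2 * R) → ‖((Fnu W R a s : lieSU n) : Matrix n n ℂ)‖ ≤ mF)
    (hLs : ∀ a s : ℕ, (a = 0 ∨ a = 2 * R) → s + 1 ≤ 2 * R → ‖((Fnu W R a (s + 1) : lieSU n) : Matrix n n ℂ) - ((Fnu W R a s : lieSU n) : Matrix n n ℂ)‖ ≤ ℓs)
    (a s : ℕ) (ha : a ≤ 2 * R) (hs : s + 1 ≤ 2 * R) :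
    ‖((psi W R a (s + 1) : lieSU n) : Matrix n n ℂ) - ((psi W R a s : lieSU n) : Matrix n n ℂ)‖ ≤ ℓs + 2 * mF / (2 * R : ℕ) := by
  have hN : (0 : ℝ) < ((2 * R : ℕ) : ℝ) := by positivity
  have hr0 : 0 ≤ (a : ℝ) / (2 * R : ℕ) := by positivity
  have hr1 : (a : ℝ) / (2 * R : ℕ) ≤ 1 := by rw [div_le_one hN]; exact_mod_cast ha
  set A := ((Fnu W R a (2 * R) : lieSU n) : Matrix n n ℂ)
  set B := ((Fnu W R 0 s : lieSU n) : Matrix n n ℂ)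
  set B' := ((Fnu W R 0 (s + 1) : lieSU n) : Matrix n n ℂ)
  set C := ((Fnu W R (2 * R) s : lieSU n) : Matrix n n ℂ)
  set C' := ((Fnu W R (2 * R) (s + 1) : lieSU n) : Matrix n n ℂ)
  set D := ((Fnu W R 0 (2 * R) : lieSU n) : Matrix n n ℂ)
  set E := ((Fnu W R (2 * R) (2 * R) : lieSU n) : Matrix n n ℂ)
  have e : ((psi W R a (s + 1) : lieSU n) : Matrix n n ℂ) - ((psi W R a s : lieSU n) : Matrix n n ℂ) =
      (1 / ((2 * R : ℕ) : ℝ)) • (A - ((1 - (a : ℝ) / (2 * R : ℕ)) • D + ((a : ℝ) / (2 * R : ℕ)) • E)) + ((1 - (a : ℝ) / (2 * R : ℕ)) • (B' - B) + ((a : ℝ) / (2 * R : ℕ)) • (C' - C)) := by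
    simp only [psi, Submodule.coe_add, Submodule.coe_sub, Submodule.coe_smul, A, B, B', C, C', D, E]
    push_cast
    module
  rw [e]
  have hA := hF a _ ha le_rfl (Or.inr (Or.inr rfl))
  have hD := hF 0 _ (Nat.zero_le _) le_rfl (Or.inl rfl)
  have hE := hF _ _ le_rfl le_rfl (Or.inr (Or.inl rfl))
  have hmF : 0 ≤ mF := (norm_nonneg _).trans hA
  have hDE : ‖(1 - (a : ℝ) / (2 * R : ℕ)) • D + ((a : ℝ) / (2 * R : ℕ)) • E‖ ≤ mF := by
    calc _ ≤ ‖(1 - (a : ℝ) / (2 * R : ℕ)) • D‖ + ‖((a : ℝ) / (2 * R : ℕ)) • E‖ := norm_add_le _ _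
      _ ≤ (1 - (a : ℝ) / (2 * R : ℕ)) * mF + ((a : ℝ) / (2 * R : ℕ)) * mF := by
          rw [norm_smul, norm_smul, Real.norm_eq_abs, Real.norm_eq_abs, abs_of_nonneg (by linarith), abs_of_nonneg hr0]
          exact add_le_add (mul_le_mul_of_nonneg_left hD (by linarith)) (mul_le_mul_of_nonneg_left hE hr0)
      _ = mF := by ring
  have h1 : ‖(1 / ((2 * R : ℕ) : ℝ)) • (A - ((1 - (a : ℝ) / (2 * R : ℕ)) • D + ((a : ℝ) / (2 * R : ℕ)) • E))‖ ≤ 2 * mF / (2 * R : ℕ) := by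
    rw [norm_smul, Real.norm_eq_abs, abs_of_nonneg (by positivity)]
    calc _ ≤ (1 / ((2 * R : ℕ) : ℝ)) * (‖A‖ + ‖(1 - (a : ℝ) / (2 * R : ℕ)) • D + ((a : ℝ) / (2 * R : ℕ)) • E‖) :=
          mul_le_mul_of_nonneg_left (norm_sub_le _ _) (by positivity)
      _ ≤ (1 / ((2 * R : ℕ) : ℝ)) * (mF + mF) := mul_le_mul_of_nonneg_left (add_le_add hA hDE) (by positivity)
      _ = 2 * mF / (2 * R : ℕ) := by ring
  have h2 : ‖(1 - (a : ℝ) / (2 * R : ℕ)) • (B' - B) + ((a : ℝ) / (2 * R : ℕ)) • (C' - C)‖ ≤ ℓs := by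
    calc _ ≤ ‖(1 - (a : ℝ) / (2 * R : ℕ)) • (B' - B)‖ + ‖((a : ℝ) / (2 * R : ℕ)) • (C' - C)‖ := norm_add_le _ _
      _ ≤ (1 - (a : ℝ) / (2 * R : ℕ)) * ℓs + ((a : ℝ) / (2 * R : ℕ)) * ℓs := by
          rw [norm_smul, norm_smul, Real.norm_eq_abs, Real.norm_eq_abs, abs_of_nonneg (by linarith), abs_of_nonneg hr0]
          exact add_le_add (mul_le_mul_of_nonneg_left (hLs 0 s (Or.inl rfl) hs) (by linarith)) (mul_le_mul_of_nonneg_left (hLs _ s (Or.inr rfl) hs) hr0)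
      _ = ℓs := by ring
  calc _ ≤ ‖(1 / ((2 * R : ℕ) : ℝ)) • (A - ((1 - (a : ℝ) / (2 * R : ℕ)) • D + ((a : ℝ) / (2 * R : ℕ)) • E))‖ +
        ‖(1 - (a : ℝ) / (2 * R : ℕ)) • (B' - B) + ((a : ℝ) / (2 * R : ℕ)) • (C' - C)‖ := norm_add_le _ _
    _ ≤ 2 * mF / (2 * R : ℕ) + ℓs := add_le_add h1 h2
    _ = ℓs + 2 * mF / (2 * R : ℕ) := by ring

/-- `‖exp X − exp Y‖ ≤ ‖X − Y‖·(8/5)` when `‖X‖, ‖Y‖ ≤ 3/8` (`Literature.Analysis.Complex.norm_exp_sub_exp_le` and `e^{3/8} ≤ 1/(1 − 3/8)`). [folklore] -/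
theorem norm_exp_sub_exp_le_of_small (X Y : Matrix n n ℂ) (hX : ‖X‖ ≤ 3 / 8) (hY : ‖Y‖ ≤ 3 / 8) : ‖exp X - exp Y‖ ≤ ‖X - Y‖ * (8 / 5) := by
  have h := Literature.Analysis.Complex.norm_exp_sub_exp_le X Y
  have hmax : max ‖X‖ ‖Y‖ ≤ 3 / 8 := max_le hX hY
  have hexp : Real.exp (max ‖X‖ ‖Y‖) ≤ 8 / 5 := by
    calc Real.exp (max ‖X‖ ‖Y‖) ≤ Real.exp (3 / 8) := Real.exp_le_exp.mpr hmax
      _ ≤ 1 / (1 - 3 / 8) := Real.exp_bound_div_one_sub_of_interval (by norm_num) (by norm_num)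
      _ = 8 / 5 := by norm_num
  exact h.trans (mul_le_mul_of_nonneg_left hexp (norm_nonneg _))

/-- **THE GAUGED TOP BONDS**: with `‖ψ‖ ≤ 3/8` at both ends, a top rung is within `dist1(rung) + (8/5)‖Δ_a ψ‖` of `1` and a top column bond within `(8/5)‖Δ_s ψ‖`.
[cite: Balaban1985Averaging, (19)–(20) p.21, pp.24–25] -/
theorem norm_gaugedTop_sub_one_le (c : Matrix.specialUnitaryGroup n ℂ) (ψ ψ' : lieSU n)
    (hψ : ‖(ψ : Matrix n n ℂ)‖ ≤ 3 / 8) (hψ' : ‖(ψ' : Matrix n n ℂ)‖ ≤ 3 / 8) :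
    ‖((expSU ψ * c * (expSU ψ')⁻¹ : Matrix.specialUnitaryGroup n ℂ) : Matrix n n ℂ) - 1‖ ≤ dist1 c + ‖(ψ : Matrix n n ℂ) - (ψ' : Matrix n n ℂ)‖ * (8 / 5) := by
  have hinv : (((expSU ψ')⁻¹ : Matrix.specialUnitaryGroup n ℂ) : Matrix n n ℂ) = star ((expSU ψ' : Matrix.specialUnitaryGroup n ℂ) : Matrix n n ℂ) := rfl
  rw [Submonoid.coe_mul, Submonoid.coe_mul, hinv]
  refine (norm_conj_unitary_sub_one_le _ _ _).trans (add_le_add (le_of_eq (FederbushMean.dist1_SU_eq c).symm) ?_)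
  rw [coe_expSU, coe_expSU]
  exact norm_exp_sub_exp_le_of_small _ _ hψ hψ'

end Coons

end Summit.QuantumFields.YangMills.Theorems.SphereAxialGauge

end
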